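/-
Copyright (c) 2026 the pub-hodgecm-mathlib formalisation cell (harness21).  Prover seat hodgecm-mathlib-R90-C10-p08 (g2), SLAB R90-TF, section S1 «Ch. 10∕12 local»;
crux H413 = `stmt-HodgeConjecture-24833`; line (D-1) «B_pos» of U4Keys :182 ∕ (S-RT), card (6a-F) contingency (R-S1-25 ∕ R-S1-27: (G1)(G2)(G4) of R90-C10-p04 (g2)'s (6a) fall to
this seat after (a′)).  KERNEL module: THEOREMS ONLY (no definition, no named fact, no `sorry`, no instance, no notation).  2026-09-05.
-/
import Summits.HodgeConjecture.HodgeConjecture.Theorems.R90S1BposRamSkewLineCayley      -- ★ p864158 (this seat): brings ★ (B-4) PART 1∕2 tools (`HeisRing.smulSkew`, `map_smulSkew_eq`, `skewModulus_eq_sqrt`, `exists_conjLocal_skew_unit`)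
import HarnessLib

/-!
# R90-TF S1 «Ch10-local» ∕ U4Keys :182, BRANCH B, POSITIVE DEPTH, TAME RAMIFIED — (6a) (G1): COVARIANCE OF THE LEVEL-ONE SPHERE FIBRE UNDER `σ`-FIXED UNITS
# «`Φ(e·a) = χ₁(e)⁻¹·Φ(a)` for a `σ`-fixed unit `e` with `|e_w| = 1`», `Φ(a) := ∫_{s ∈ R⁻, |s_w| = e⁻¹} Ē(a − s) dμ⁻` [Keys1984 §7 Thm (2); WeilBNT1967 Ch. II §5]

Cell `pub/hodgecm-mathlib`, crux H413 = `stmt-HodgeConjecture-24833`, route `HCCMUnconditional`; S1 card (6a-F) (G1) (R-S1-25∕27 contingency; R90-C10-p04 (g2)'s HEADS 01:32:31Z).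
THEOREMS ONLY; `--supports stmt-HodgeConjecture-24833 --as helper`, count-neutral; NOT THE PAYER of :182.
WHAT.  The odd cut-off shells of the ramified Casselman pair reduce (★ p864337 + ★ p864416, R90-C10-p07 (g2)) to the level-one sphere fibre `Φ(a′)`, `a′ = l^{κ+1}a(x)` `σ`-fixed; the
(6e) rows need `Φ` to be CONSTANT on each `x`-sphere.  Two points `x, x₀` of the same valuation differ by a unit `g` of `R` and `a(gx) = N(g)·a(x)` with `N(g) = g·σg` a `σ`-FIXED unit of
valuation one, so constancy is the covariance (G1) + Branch B (`χ₁(N g) = 1`).  (G1): substitute `s = e·s′` on the sphere (★ `HeisRing.smulSkew`, `μ⁻`-preserving because `‖e‖_R = 1`,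
sphere-stable because `|e_w| = 1`) and pull `e` out of `Ē` (`Ē(e·r) = χ₁(e)⁻¹Ē(r)`: a multiple of a non-unit is a non-unit).  Valid for EVERY `a ∈ R`, both sub-branches ((R-a):
`χ₁(e)⁻¹ = 1` by `hfix`; (R-b): the sign `ε(e)`).  No import of p04's PART 1∕2 (their ★ is pending): the one algebraic step is inlined.
* **`setIntegral_sphere_diteInv_units_mul_sub`** — `Φ(e·a) = ((χ₁ e)⁻¹ : ℂ) * Φ(a)`.
HONEST LABEL.  HC_CM is proved only modulo the 7 printed citations (2 remaining named inputs: hLiu418 = `stmt-HodgeConjecture-24832`, h413 = `stmt-HodgeConjecture-24833`) until rung 0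
closes; count-neutral — pays NO socket (:182, (S-RT), A2′ OPEN); no printed citation discharged; wild corner (`v ∣ 2`) not addressed.

## References
* [Keys1984] D. Keys, *Principal series representations of special unitary groups over local fields*, Compositio Math. 51 (1984), §4–§5, §7 Theorem (2) p. 126.
* [WeilBNT1967] A. Weil, *Basic Number Theory* (1967), Ch. I §2, Ch. II §5.
-/

set_option autoImplicit false
set_option linter.dupNamespace false  -- the mandated namespace has the single-problem summit's repeated segment (`HodgeConjecture.HodgeConjecture`)

noncomputable section

open NumberField IsDedekindDomain MeasureTheory Measure Topology Set
open scoped NNReal ENNReal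
open Literature.NumberTheory Literature.NumberTheory.Automorphic Literature.NumberTheory.Automorphic.UnitaryGroup

namespace Summit.HodgeConjecture.HodgeConjecture.R90.S1.BposRamGaussSphereCovariance

open Summit.HodgeConjecture.HodgeConjecture.Cruxes.H413
open Summit.HodgeConjecture.HodgeConjecture.Cruxes.H413.K2E3BranchBSkewUnitSign
open Summit.HodgeConjecture.HodgeConjecture.Cruxes.H413.K2E3BranchBSkewLineIntegrals
open Summit.HodgeConjecture.HodgeConjecture.Cruxes.H413.K2E3BranchBSkewLineCharacterIntegral
open Summit.HodgeConjecture.HodgeConjecture.R90.S1.BposSkewBallCharacterTools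

variable (L : Type) [Field L] [NumberField L] [IsCMField L] (v : HeightOneSpectrum (𝓞 ↥(maximalRealSubfield L)))
  (w : PlacesOver L v) (hw : IsCMField.complexConj L • w.1 = w.1)

variable [MeasurableSpace (LocalRing L v)] [BorelSpace (LocalRing L v)]
  (μY : Measure ↥(HeisRing.skewPart (conjLocal L (IsCMField.complexConj L) v))) [μY.IsAddHaarMeasure] [μY.Regular]
  (χ₁ : (LocalRing L v)ˣ →* ℂˣ)

open scoped Classical in
include hw in
/-- **(G1) COVARIANCE — `Φ(e·a) = χ₁(e)⁻¹·Φ(a)`**: for a `σ`-fixed unit `e` of `R` with `|e_w| = 1`, every `a ∈ R` and every regular additive Haar measure `μ⁻` on `R⁻`,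
`∫_{|s_w| = e⁻¹} Ē(e·a − s) dμ⁻(s) = χ₁(e)⁻¹·∫_{|s_w| = e⁻¹} Ē(a − s) dμ⁻(s)` (`Ē r = χ₁(r̂)⁻¹`, `0` off units): `s ↦ e·s` (★ `HeisRing.smulSkew`) preserves `μ⁻` (`‖e‖_R = 1`, ★
`map_smulSkew_eq` ∕ `skewModulus_eq_sqrt` ∕ `unitModulusChar_eq_one_of_forall_v_eq_one`) and the sphere, and `Ē(e·(a − s)) = χ₁(e)⁻¹·Ē(a − s)`.
[cite: Keys1984, §4–§5, §7 Theorem (2) p. 126] [cite: WeilBNT1967, Ch. II §5] -/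
theorem setIntegral_sphere_diteInv_units_mul_sub (e : (LocalRing L v)ˣ) (heσ : conjLocal L (IsCMField.complexConj L) v (e : LocalRing L v) = e)
    (hev : Valued.v ((e : LocalRing L v) w) = 1) (a : LocalRing L v) :
    ∫ s in {s : ↥(HeisRing.skewPart (conjLocal L (IsCMField.complexConj L) v)) | Valued.v ((s : LocalRing L v) w) = WithZero.exp (-1 : ℤ)},
        (fun r : LocalRing L v => if h : IsUnit r then (((χ₁ h.unit)⁻¹ : ℂˣ) : ℂ) else 0) ((e : LocalRing L v) * a - (s : LocalRing L v)) ∂μY =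
      (((χ₁ e)⁻¹ : ℂˣ) : ℂ) *
        ∫ s in {s : ↥(HeisRing.skewPart (conjLocal L (IsCMField.complexConj L) v)) | Valued.v ((s : LocalRing L v) w) = WithZero.exp (-1 : ℤ)},
          (fun r : LocalRing L v => if h : IsUnit r then (((χ₁ h.unit)⁻¹ : ℂˣ) : ℂ) else 0) (a - (s : LocalRing L v)) ∂μY := by
  haveI : SecondCountableTopology (LocalRing L v) := secondCountableTopology_localRing (E := L) v
  have hσ := conjLocal_conjLocal_cm L v
  have hσc := continuous_conjLocal L (IsCMField.complexConj L) v
  set E : LocalRing L v → ℂ := fun r : LocalRing L v => if h : IsUnit r then (((χ₁ h.unit)⁻¹ : ℂˣ) : ℂ) else 0 with hEdef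
  set S : Set ↥(HeisRing.skewPart (conjLocal L (IsCMField.complexConj L) v)) := {s | Valued.v ((s : LocalRing L v) w) = WithZero.exp (-1 : ℤ)} with hSdef
  -- the algebraic step `Ē(e·r) = χ₁(e)⁻¹·Ē(r)`
  have hmul : ∀ r : LocalRing L v, E ((e : LocalRing L v) * r) = (((χ₁ e)⁻¹ : ℂˣ) : ℂ) * E r := by
    intro r
    by_cases hr : IsUnit r
    · have her : IsUnit ((e : LocalRing L v) * r) := e.isUnit.mul hr
      have hunit : her.unit = e * hr.unit := Units.ext (by rw [IsUnit.unit_spec, Units.val_mul, IsUnit.unit_spec])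
      simp only [hEdef, dif_pos her, dif_pos hr, hunit, map_mul, mul_inv, Units.val_mul]
    · have her : ¬ IsUnit ((e : LocalRing L v) * r) := fun h => hr (by
        have h' := (e⁻¹).isUnit.mul h
        rwa [← mul_assoc, Units.inv_mul, one_mul] at h')
      simp only [hEdef, dif_neg her, dif_neg hr, mul_zero]
  -- the substitution `s ↦ e·s` preserves `μ⁻` and the sphere
  set T := HeisRing.smulSkew (conjLocal L (IsCMField.complexConj L) v) e heσ with hT
  obtain ⟨δ, hδ⟩ := exists_conjLocal_skew_unit L v
  have hmod : HeisRing.skewModulus (conjLocal L (IsCMField.complexConj L) v) hσc e heσ = 1 := by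
    rw [HeisRing.skewModulus_eq_sqrt (conjLocal L (IsCMField.complexConj L) v) hσ hσc δ hδ e heσ,
      show distribHaarChar (LocalRing L v) e = unitModulusChar (LocalRing L v) e from rfl,
      unitModulusChar_eq_one_of_forall_v_eq_one L v e (forall_placesOver_of_apply L v w hw hev), NNReal.sqrt_one]
  have hpres : MeasurePreserving T μY μY := by
    refine ⟨T.continuous.measurable, ?_⟩
    rw [hT, HeisRing.map_smulSkew_eq (conjLocal L (IsCMField.complexConj L) v) hσc e heσ μY, hmod, inv_one, one_smul]
  have hpre : T ⁻¹' S = S := by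
    ext s
    rw [Set.mem_preimage, hSdef, Set.mem_setOf_eq, Set.mem_setOf_eq, hT, HeisRing.coe_smulSkew, Pi.mul_apply, map_mul, hev, one_mul]
  have key := hpres.setIntegral_preimage_emb T.toHomeomorph.measurableEmbedding
    (fun s : ↥(HeisRing.skewPart (conjLocal L (IsCMField.complexConj L) v)) => E ((e : LocalRing L v) * a - (s : LocalRing L v))) S
  rw [hpre] at key
  -- `Ē(e·a − e·s) = χ₁(e)⁻¹·Ē(a − s)`
  have hpt : ∀ s : ↥(HeisRing.skewPart (conjLocal L (IsCMField.complexConj L) v)),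
      E ((e : LocalRing L v) * a - ((T s : ↥(HeisRing.skewPart (conjLocal L (IsCMField.complexConj L) v))) : LocalRing L v)) =
        (((χ₁ e)⁻¹ : ℂˣ) : ℂ) * E (a - (s : LocalRing L v)) := by
    intro s
    rw [hT, HeisRing.coe_smulSkew, ← mul_sub, hmul]
  rw [← key]
  simp_rw [hpt]
  exact integral_const_mul _ _

end Summit.HodgeConjecture.HodgeConjecture.R90.S1.BposRamGaussSphereCovariance

end
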